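import Summits.AtomisticToContinuum.Crystallization.Theorems.ChargedEnergyGapRoofDuality
import HarnessLib

/-!
# BasisRepr (lens-3 g90, NODE 105) — the roof majorant of a census cell in BASIS FORM (CELLCERT v0.2 §1 «piece», made generic)

Fourth cost-side piece.  Tree E8 `roofVal_T75_le_of_repr` (NODE 93) bounds `roofVal T75 W ≤ Σᵢ λᵢ sᵢ` from an explicit representation
`W = Σᵢ λᵢ · (relabel gᵢ σᵢ) Wᵢ`, `λ ≥ 0`.  On a census cell the optimal LP basis is FIXED: six relabelled table patterns forming an invertible
`6 × 6` matrix `B` (`B p i = Wᵢ(relabel gᵢ σᵢ p)`), and `λ = B⁻¹W`.  This file checks `B·B⁻¹ = I` ONCE PER BASIS (36 rational identities, shared by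
every cell using that basis) and then delivers, for EVERY weight vector `W` with `B⁻¹W ≥ 0`, the representation and the price bound
`roofVal T75 W ≤ Σ_q y_B q · W q` with `y_B q = Σᵢ sᵢ (B⁻¹) i q`; the «on-envelope» version takes componentwise weight envelopes `L ≤ W ≤ U`
(NODE 103 rows, affine in the cell displacement) and SIGN-SELECTS (`lowSel` / `highSel`, decided by the sign of a fixed rational) so that both the
non-negativity rows and the majorant stay affine in the envelopes:
* `roofBasisMat`, `IsBasisInverse`, `basisLam`, `basisPrice`; `repr_of_basisInverse`; ★ `roofVal_T75_le_of_basis`; `basis_value_eq_price`; ★ `roofVal_T75_le_price`;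
* `lowSel`/`highSel` + `lowSel_le_mul` / `mul_le_highSel`; ★★ `roofVal_T75_le_on_env`;
* §105.3 `T75_length` (= 203, `rfl` under ONE scoped `set_option maxRecDepth 8000 in` — tree precedent) and `mem_T75_of_getElem_eq` (basis rows by index).
-/

noncomputable section
open scoped Classical
open Finset
open Literature.MathematicalPhysics.StatisticalMechanics Literature.Geometry.DiscreteGeometry
open Summit.AtomisticToContinuum.Crystallization.Theses.PricedLinkCensus
open Summit.AtomisticToContinuum.Crystallization.Theorems.ChargedEnergyGapNegative

namespace Summit.AtomisticToContinuum.Crystallization.Theorems.ChargedEnergyGapChartDial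

/-- The basis matrix of six relabelled table patterns: `B p i = Wᵢ (relabel gᵢ σᵢ p)`. -/
def roofBasisMat (w : Fin 6 → (Fin 3 × Bool → ℝ) × ℝ) (g : Fin 6 → Fin 6) (σ : Fin 6 → Fin 8) (p : Fin 3 × Bool) (i : Fin 6) : ℝ :=
  (w i).1 (relabel (g i) (σ i) p)

/-- `Binv` is a right inverse of the basis matrix: `Σᵢ B p i · Binv i q = [p = q]` (36 rational identities per basis). -/
def IsBasisInverse (w : Fin 6 → (Fin 3 × Bool → ℝ) × ℝ) (g : Fin 6 → Fin 6) (σ : Fin 6 → Fin 8) (Binv : Fin 6 → (Fin 3 × Bool) → ℝ) : Prop :=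
  ∀ p q : Fin 3 × Bool, ∑ i, roofBasisMat w g σ p i * Binv i q = if p = q then 1 else 0

/-- The basic multipliers `λ = B⁻¹ W`. -/
def basisLam (Binv : Fin 6 → (Fin 3 × Bool) → ℝ) (Wv : Fin 3 × Bool → ℝ) (i : Fin 6) : ℝ := ∑ q, Binv i q * Wv q

/-- The basis price vector `y_B q = Σᵢ sᵢ (B⁻¹) i q`. -/
def basisPrice (w : Fin 6 → (Fin 3 × Bool → ℝ) × ℝ) (Binv : Fin 6 → (Fin 3 × Bool) → ℝ) (q : Fin 3 × Bool) : ℝ := ∑ i, (w i).2 * Binv i q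

/-- `B·B⁻¹ = I` gives the representation `W = Σᵢ (B⁻¹W)ᵢ · (relabel gᵢ σᵢ) Wᵢ` for EVERY `W`. -/
theorem repr_of_basisInverse {w : Fin 6 → (Fin 3 × Bool → ℝ) × ℝ} {g : Fin 6 → Fin 6} {σ : Fin 6 → Fin 8} {Binv : Fin 6 → (Fin 3 × Bool) → ℝ}
    (hB : IsBasisInverse w g σ Binv) (Wv : Fin 3 × Bool → ℝ) :
    ∀ p, Wv p = ∑ i, basisLam Binv Wv i * (w i).1 (relabel (g i) (σ i) p) := by
  intro p
  have h1 : ∑ i, basisLam Binv Wv i * (w i).1 (relabel (g i) (σ i) p) = ∑ q, (∑ i, roofBasisMat w g σ p i * Binv i q) * Wv q := by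
    simp only [basisLam, roofBasisMat, Finset.sum_mul]
    rw [Finset.sum_comm]
    exact Finset.sum_congr rfl fun q _ => Finset.sum_congr rfl fun i _ => by ring
  rw [h1, Finset.sum_congr rfl fun q _ => by rw [hB p q]]
  simp only [ite_mul, one_mul, zero_mul, Finset.sum_ite_eq, Finset.mem_univ, if_true]

/-- ★ ROOF MAJORANT IN BASIS FORM: `B·B⁻¹ = I`, rows in `T75`, `B⁻¹W ≥ 0` ⇒ `roofVal T75 W ≤ Σᵢ (B⁻¹W)ᵢ sᵢ`. -/
theorem roofVal_T75_le_of_basis {w : Fin 6 → (Fin 3 × Bool → ℝ) × ℝ} {g : Fin 6 → Fin 6} {σ : Fin 6 → Fin 8} {Binv : Fin 6 → (Fin 3 × Bool) → ℝ}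
    (hw : ∀ i, w i ∈ T75) (hB : IsBasisInverse w g σ Binv) (Wv : Fin 3 × Bool → ℝ) (hl : ∀ i, 0 ≤ basisLam Binv Wv i) :
    roofVal T75 Wv ≤ ∑ i, basisLam Binv Wv i * (w i).2 :=
  roofVal_T75_le_of_repr w g σ _ hw hl (repr_of_basisInverse hB Wv)

/-- The basis value is the price form: `Σᵢ (B⁻¹W)ᵢ sᵢ = Σ_q y_B q · W q`. -/
theorem basis_value_eq_price (w : Fin 6 → (Fin 3 × Bool → ℝ) × ℝ) (Binv : Fin 6 → (Fin 3 × Bool) → ℝ) (Wv : Fin 3 × Bool → ℝ) :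
    ∑ i, basisLam Binv Wv i * (w i).2 = ∑ q, basisPrice w Binv q * Wv q := by
  simp only [basisLam, basisPrice, Finset.sum_mul]
  rw [Finset.sum_comm]
  exact Finset.sum_congr rfl fun q _ => Finset.sum_congr rfl fun i _ => by ring

/-- ★ `roofVal T75 W ≤ y_B · W` on the basis cone. -/
theorem roofVal_T75_le_price {w : Fin 6 → (Fin 3 × Bool → ℝ) × ℝ} {g : Fin 6 → Fin 6} {σ : Fin 6 → Fin 8} {Binv : Fin 6 → (Fin 3 × Bool) → ℝ}
    (hw : ∀ i, w i ∈ T75) (hB : IsBasisInverse w g σ Binv) (Wv : Fin 3 × Bool → ℝ) (hl : ∀ i, 0 ≤ basisLam Binv Wv i) :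
    roofVal T75 Wv ≤ ∑ q, basisPrice w Binv q * Wv q :=
  (roofVal_T75_le_of_basis hw hB Wv hl).trans_eq (basis_value_eq_price w Binv Wv)

/-! ## §105.2 Sign selection against componentwise envelopes `L ≤ W ≤ U` -/

/-- The lower selector of `c · x` over `x ∈ [l, u]`, decided by the sign of the FIXED coefficient `c`. -/
def lowSel (c l u : ℝ) : ℝ := if 0 ≤ c then c * l else c * u

/-- The upper selector of `c · x` over `x ∈ [l, u]`. -/
def highSel (c l u : ℝ) : ℝ := if 0 ≤ c then c * u else c * l

/-- `l ≤ x ≤ u ⇒ lowSel c l u ≤ c·x` (sign split on `c`). [formal bookkeeping; lane docstring, hand-2 g43] -/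
theorem lowSel_le_mul (c : ℝ) {l u x : ℝ} (hl : l ≤ x) (hu : x ≤ u) : lowSel c l u ≤ c * x := by
  unfold lowSel
  split_ifs with hc
  · exact mul_le_mul_of_nonneg_left hl hc
  · exact mul_le_mul_of_nonpos_left hu (le_of_lt (not_le.1 hc))

/-- `l ≤ x ≤ u ⇒ c·x ≤ highSel c l u` (sign split on `c`). [formal bookkeeping; lane docstring, hand-2 g43] -/
theorem mul_le_highSel (c : ℝ) {l u x : ℝ} (hl : l ≤ x) (hu : x ≤ u) : c * x ≤ highSel c l u := by
  unfold highSel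
  split_ifs with hc
  · exact mul_le_mul_of_nonneg_left hu hc
  · exact mul_le_mul_of_nonpos_left hl (le_of_lt (not_le.1 hc))

/-- ★★ THE CELL ROOF ROW: with weight envelopes `L ≤ W ≤ U` (NODE 103), the non-negativity rows `Σ_q lowSel (B⁻¹ i q) (L q) (U q) ≥ 0` (one per basic
variable; affine in the envelopes, so ONE rational check each on the cell by NODE 104) give `roofVal T75 W ≤ Σ_q highSel (y_B q) (L q) (U q)`. -/
theorem roofVal_T75_le_on_env {w : Fin 6 → (Fin 3 × Bool → ℝ) × ℝ} {g : Fin 6 → Fin 6} {σ : Fin 6 → Fin 8} {Binv : Fin 6 → (Fin 3 × Bool) → ℝ}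
    (hw : ∀ i, w i ∈ T75) (hB : IsBasisInverse w g σ Binv) {Wv L U : Fin 3 × Bool → ℝ} (hWl : ∀ q, L q ≤ Wv q) (hWu : ∀ q, Wv q ≤ U q)
    (hl : ∀ i, 0 ≤ ∑ q, lowSel (Binv i q) (L q) (U q)) :
    roofVal T75 Wv ≤ ∑ q, highSel (basisPrice w Binv q) (L q) (U q) := by
  have hl' : ∀ i, 0 ≤ basisLam Binv Wv i := fun i =>
    (hl i).trans (Finset.sum_le_sum fun q _ => lowSel_le_mul _ (hWl q) (hWu q))
  exact (roofVal_T75_le_price hw hB Wv hl').trans (Finset.sum_le_sum fun q _ => mul_le_highSel _ (hWl q) (hWu q))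

/-! ## §105.3 Row access for census bases (basis rows BY INDEX `T75[k]`; ONE scoped `maxRecDepth`, tree precedent DualPriceStar §96.3 / RoofDuality §93.1) -/

set_option maxRecDepth 8000 in
/-- The roof table has `203` rows (`6` unit patterns + `197` representatives). -/
theorem T75_length : T75.length = 203 := rfl

/-- A row given by its INDEX is in the table: the census states each basis row as an equation `T75[k] = (sext …, s)` proved by `rfl`
(under the same scoped option) and gets membership for free. -/
theorem mem_T75_of_getElem_eq {k : ℕ} (hk : k < T75.length) {e : (Fin 3 × Bool → ℝ) × ℝ} (h : T75[k] = e) : e ∈ T75 :=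
  h ▸ List.getElem_mem hk

end Summit.AtomisticToContinuum.Crystallization.Theorems.ChargedEnergyGapChartDial

end
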